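import Mathlib.AlgebraicGeometry.AffineScheme
import HarnessLib

/-!
# Points of an affine scheme over `Spec R` with values in `Spec S` are ring maps `Γ(P) → S` over `R` (Stacks 01I1)

Topic `Literature/AlgebraicGeometry/Morphisms`; namespace `Literature.AlgebraicGeometry.Morphisms`.  PROOF FILE (theorems only; no
definition, no named fact, no instance, no `sorry`).  Cell `hodgecm-mathlib` (D-0151), FLOOR-0 P5a, row (S-γ2) L2b of F0P5a-p02's
step list («the scheme ↔ algebra bridge for the finite base change»): for an AFFINE scheme `P` over `Spec R` and any commutative ring
`S` with `h : R → S`, the `Spec S`-valued points of `P` over `Spec R` are in canonical bijection with the ring maps `ψ : Γ(P, ⊤) → S`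
under `R`:

  `{t : Spec S ⟶ P // t ≫ q = Spec.map h} ≃ {ψ : Γ(P, ⊤) ⟶ S // (ΓSpecIso R).inv ≫ q.appTop ≫ ψ = h}`,  `t ↦ t.appTop ≫ (ΓSpecIso S).hom`,

with inverse `ψ ↦ Spec.map ψ ≫ P.isoSpec.inv`.  This is [Stacks 01I1] («`Mor(X, Y) → Hom(Γ(Y, 𝒪_Y), Γ(X, 𝒪_X))` is bijective for `Y`
affine», [EGA I, Err. 1.8.1]) for `X = Spec S`, composed with `Γ(Spec S) = S`, plus the bookkeeping of the structure maps.

* `specMap_appTop_comp_ΓSpecIso_hom_comp_isoSpec_inv` — `Spec.map (t.appTop ≫ (ΓSpecIso S).hom) ≫ P.isoSpec.inv = t`;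
* `appTop_specMap_comp_isoSpec_inv_comp_ΓSpecIso_hom` — `(Spec.map ψ ≫ P.isoSpec.inv).appTop ≫ (ΓSpecIso S).hom = ψ`;
* `bijective_appTop_comp_ΓSpecIso_hom` — [Stacks 01I1] for `X = Spec S`: `t ↦ t.appTop ≫ (ΓSpecIso S).hom` is a bijection
  `(Spec S ⟶ P) → (Γ(P, ⊤) ⟶ S)`;
* `comp_eq_specMap_iff` — `t ≫ q = Spec.map h ↔ (ΓSpecIso R).inv ≫ q.appTop ≫ (t.appTop ≫ (ΓSpecIso S).hom) = h`;
* **`bijective_appTop_comp_ΓSpecIso_hom_over`**, **`nonempty_equiv_specHom_over`** — the relative statement displayed above;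
  `natCard_specHom_over_eq`, `finite_specHom_over_iff` — its counting / finiteness transports.

HC_CM is proved only modulo the 7 printed citations until rung 0 closes; this file is generic scheme theory.

## References
* [StacksProject] The Stacks project, Tag 01I1 = Schemes, Lemma 26.6.4 (morphisms into an affine scheme = ring maps on global
  sections; attributed to Tate, [EGA I, Err. 1.8.1]).
-/

set_option autoImplicit false

noncomputable section

universe u

open CategoryTheory AlgebraicGeometry Opposite

namespace Literature.AlgebraicGeometry.Morphisms

variable {P : Scheme.{u}} [IsAffine P] {R S : CommRingCat.{u}}

/-- **Reconstruction of a `Spec S`-valued point from its map on global sections**: for `P` affine and `t : Spec S ⟶ P`,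
`Spec.map (t.appTop ≫ (ΓSpecIso S).hom) ≫ P.isoSpec.inv = t`. [cite: StacksProject, Tag 01I1] -/
theorem specMap_appTop_comp_ΓSpecIso_hom_comp_isoSpec_inv (t : Spec S ⟶ P) :
    Spec.map (t.appTop ≫ (Scheme.ΓSpecIso S).hom) ≫ P.isoSpec.inv = t := by
  rw [Spec.map_comp, Category.assoc, SpecMap_ΓSpecIso_hom, ← Category.assoc, Iso.comp_inv_eq, Scheme.isoSpec_hom]
  exact (Scheme.toSpecΓ_naturality t).symm

/-- **The map on global sections of the point attached to `ψ : Γ(P, ⊤) ⟶ S`** is `ψ`: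
`(Spec.map ψ ≫ P.isoSpec.inv).appTop ≫ (ΓSpecIso S).hom = ψ`. [cite: StacksProject, Tag 01I1] -/
theorem appTop_specMap_comp_isoSpec_inv_comp_ΓSpecIso_hom (ψ : Γ(P, ⊤) ⟶ S) :
    (Spec.map ψ ≫ P.isoSpec.inv).appTop ≫ (Scheme.ΓSpecIso S).hom = ψ := by
  have hinv : P.isoSpec.inv.appTop = (Scheme.ΓSpecIso Γ(P, ⊤)).inv := by
    have h := congrArg Scheme.Hom.appTop P.isoSpec.inv_hom_id
    rw [Scheme.Hom.comp_appTop, Scheme.Hom.id_appTop] at h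
    change P.toSpecΓ.appTop ≫ P.isoSpec.inv.appTop = 𝟙 _ at h
    rw [Scheme.toSpecΓ_appTop] at h
    rw [← Category.id_comp P.isoSpec.inv.appTop, ← (Scheme.ΓSpecIso Γ(P, ⊤)).inv_hom_id, Category.assoc, h,
      Category.comp_id]
  rw [Scheme.Hom.comp_appTop, hinv, Category.assoc, Scheme.ΓSpecIso_naturality, Iso.inv_hom_id_assoc]

/-- **[Stacks 01I1] for `X = Spec S`**: for an affine scheme `P`, `t ↦ t.appTop ≫ (ΓSpecIso S).hom` is a bijection from
`Spec S ⟶ P` onto the ring maps `Γ(P, ⊤) ⟶ S` (inverse `ψ ↦ Spec.map ψ ≫ P.isoSpec.inv`). [cite: StacksProject, Tag 01I1] -/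
theorem bijective_appTop_comp_ΓSpecIso_hom :
    Function.Bijective fun t : Spec S ⟶ P => t.appTop ≫ (Scheme.ΓSpecIso S).hom := by
  refine ⟨fun t t' htt' => ?_, fun ψ => ⟨Spec.map ψ ≫ P.isoSpec.inv, appTop_specMap_comp_isoSpec_inv_comp_ΓSpecIso_hom ψ⟩⟩
  have h := congrArg (fun ψ : Γ(P, ⊤) ⟶ S => Spec.map ψ ≫ P.isoSpec.inv) htt'
  simpa only [specMap_appTop_comp_ΓSpecIso_hom_comp_isoSpec_inv] using h

variable (q : P ⟶ Spec R) (h : R ⟶ S)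

omit [IsAffine P] in
/-- **The structure maps correspond**: for `t : Spec S ⟶ P`, `t` lies over `Spec.map h : Spec S ⟶ Spec R` iff its ring map
`ψ = t.appTop ≫ (ΓSpecIso S).hom : Γ(P, ⊤) ⟶ S` is a map under `h` along `R ≅ Γ(Spec R) → Γ(P)`. [cite: StacksProject, Tag 01I1] -/
theorem comp_eq_specMap_iff (t : Spec S ⟶ P) :
    t ≫ q = Spec.map h ↔ (Scheme.ΓSpecIso R).inv ≫ q.appTop ≫ (t.appTop ≫ (Scheme.ΓSpecIso S).hom) = h := by
  constructor
  · intro ht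
    have h1 : q.appTop ≫ t.appTop = (Spec.map h).appTop := by rw [← Scheme.Hom.comp_appTop, ht]
    rw [← Category.assoc q.appTop, h1, Scheme.ΓSpecIso_naturality, Iso.inv_hom_id_assoc]
  · intro hψ
    refine ext_of_isAffine ?_
    rw [Scheme.Hom.comp_appTop]
    have h2 : q.appTop ≫ t.appTop ≫ (Scheme.ΓSpecIso S).hom = (Scheme.ΓSpecIso R).hom ≫ h := by
      rw [← hψ, Iso.hom_inv_id_assoc]
    rw [← Category.comp_id (q.appTop ≫ t.appTop), ← (Scheme.ΓSpecIso S).hom_inv_id, ← Category.assoc, Category.assoc q.appTop,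
      h2, Category.assoc, Scheme.ΓSpecIso_inv_naturality, Iso.hom_inv_id_assoc]

/-- **Points of an affine `P` over `Spec R` with values in `Spec S` ↔ ring maps `Γ(P, ⊤) → S` under `R`**: the map
`t ↦ t.appTop ≫ (ΓSpecIso S).hom` restricts to a bijection between `{t : Spec S ⟶ P // t ≫ q = Spec.map h}` and
`{ψ : Γ(P, ⊤) ⟶ S // (ΓSpecIso R).inv ≫ q.appTop ≫ ψ = h}`. [cite: StacksProject, Tag 01I1] -/
theorem bijective_appTop_comp_ΓSpecIso_hom_over :
    Function.Bijective fun t : {t : Spec S ⟶ P // t ≫ q = Spec.map h} =>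
      (⟨t.1.appTop ≫ (Scheme.ΓSpecIso S).hom, (comp_eq_specMap_iff q h t.1).1 t.2⟩ :
        {ψ : Γ(P, ⊤) ⟶ S // (Scheme.ΓSpecIso R).inv ≫ q.appTop ≫ ψ = h}) := by
  refine ⟨fun t t' htt' => Subtype.ext (bijective_appTop_comp_ΓSpecIso_hom.1 (congrArg Subtype.val htt')), fun ψ => ?_⟩
  refine ⟨⟨Spec.map ψ.1 ≫ P.isoSpec.inv, (comp_eq_specMap_iff q h _).2 ?_⟩, Subtype.ext ?_⟩
  · rw [appTop_specMap_comp_isoSpec_inv_comp_ΓSpecIso_hom]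
    exact ψ.2
  · exact appTop_specMap_comp_isoSpec_inv_comp_ΓSpecIso_hom ψ.1

/-- **Points of an affine `P` over `Spec R` with values in `Spec S` ≃ ring maps `Γ(P, ⊤) → S` under `R`** (`Nonempty`-`Equiv`
form of `bijective_appTop_comp_ΓSpecIso_hom_over`). [cite: StacksProject, Tag 01I1] -/
theorem nonempty_equiv_specHom_over :
    Nonempty ({t : Spec S ⟶ P // t ≫ q = Spec.map h} ≃
      {ψ : Γ(P, ⊤) ⟶ S // (Scheme.ΓSpecIso R).inv ≫ q.appTop ≫ ψ = h}) :=
  ⟨Equiv.ofBijective _ (bijective_appTop_comp_ΓSpecIso_hom_over q h)⟩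

/-- **Counting form**: the `Spec S`-valued points of the affine `P` over `Spec R` and the ring maps `Γ(P, ⊤) → S` under `R` have
the same cardinality (`Nat.card`, both sides possibly infinite). [cite: StacksProject, Tag 01I1] -/
theorem natCard_specHom_over_eq :
    Nat.card {t : Spec S ⟶ P // t ≫ q = Spec.map h} =
      Nat.card {ψ : Γ(P, ⊤) ⟶ S // (Scheme.ΓSpecIso R).inv ≫ q.appTop ≫ ψ = h} :=
  Nat.card_eq_of_bijective _ (bijective_appTop_comp_ΓSpecIso_hom_over q h)

/-- **Finiteness transports** along the bijection of `bijective_appTop_comp_ΓSpecIso_hom_over`. [cite: StacksProject, Tag 01I1] -/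
theorem finite_specHom_over_iff :
    Finite {t : Spec S ⟶ P // t ≫ q = Spec.map h} ↔
      Finite {ψ : Γ(P, ⊤) ⟶ S // (Scheme.ΓSpecIso R).inv ≫ q.appTop ≫ ψ = h} :=
  (Equiv.ofBijective _ (bijective_appTop_comp_ΓSpecIso_hom_over q h)).finite_iff

end Literature.AlgebraicGeometry.Morphisms

end
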